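import Summits.BirchSwinnertonDyer.BirchSwinnertonDyer.Theorems.ResidualThetaTransportAtTwoResidualThetaMainConjectureAtTwoEvalK
import Literature.NumberTheory.EllipticCurves.PlusMinusPAdicLFunctionProofs
import Literature.NumberTheory.EllipticCurves.RohrlichNonvanishingRankinProofs
import Literature.NumberTheory.EllipticCurves.RohrlichNonvanishingProofs
import Literature.NumberTheory.EllipticCurves.ModularSymbolsHeckeProofs
import Literature.NumberTheory.EllipticCurves.PAdicLFunctionProofs
import Literature.NumberTheory.Automorphic.Sweep1
import HarnessLib

/-!
# Crux `ResidualThetaMainConjectureAtTwo` (stmt-BirchSwinnertonDyer-20787), line `birth` v7 — stub (R1d)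
# `stub_pollackNonvanishingKAtTwo`: NON-VANISHING of the partner's signed functions `L^± ∈ 𝓞⟦T⟧` at `p = 2`
# (Pollack 2003 Cor. 5.11 over `𝓞`, from Rohrlich's theorem for the newform `g`)

Cell `bsd-wall`, seat `bsd-wall-rtt-p2` (LEAD PROVER, line mode, g2). THEOREMS ONLY (no `def`, no named fact, no
`sorry`). Proves the registered stub (R1d) of skeleton v7 VERBATIM. If `L⁻ = 0` (resp. `L⁺ = 0`) satisfied the even
(resp. odd) layer congruences, then evaluating at `χ(γ) − 1` (file `…EvalK`) every twisted sum
`Σ_a χ(a)·ι[a/2^{n+2}]⁺_{g,Ω}` at an even wild character `χ` of `2`-power order and even (resp. odd) level `n` would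
vanish in `ℂ_2`; transporting through an algebraic closure `F` of `K_g` (characters valued in `F`, embeddings
`F → ℂ` over `K_g ⊆ ℂ` and `F → ℚ̄₂` over `ι`) the complex twisted symbol sums `Σ χ(a){∞, a/2^{n+2}}_g` vanish, so by
Birch's formula (`twisted_LValue_eq_holds`, tree) `L(g, χ̄, 1) = 0` for infinitely many primitive `χ` of `2`-power
conductor — contradicting Rohrlich's theorem for `g` (`Rohrlich1984_nonvanishing_twists_holds`, tree). The rational,
odd-`p` twin is the tree's `ne_zero_of_isCongrModOmega_even/odd`. BSD is not proved by any of this.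

Refs: [Pollack2003] Cor. 5.11, Prop. 6.9; [RohrlichInventiones1984] Theorem p. 409; [Birch1971].
-/

set_option linter.dupNamespace false
set_option autoImplicit false

noncomputable section

open scoped Classical

open Polynomial Literature.NumberTheory.EllipticCurves Literature.NumberTheory.EllipticCurves.ModularForms

namespace Summit.BirchSwinnertonDyer.BirchSwinnertonDyer.Theorems.ResidualThetaLayer

section Bridge

variable {M : ℕ} [NeZero M] {g : CuspForm (CongruenceSubgroup.Gamma0 M) 2} {p : ℕ} [Fact p.Prime]
  {ι : coeffField g →+* PadicAlgCl p} {Ω : ℂ}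

omit [NeZero M] in
/-- If `θ_n(g;Ω)^ι ≡ P · 0 (mod ω_n)` in `𝓞⟦T⟧ ⊗ ℚ`, every twisted sum `Σ_a χ(a) ι[a/p^{n+e₀}]⁺_{g,Ω}` at an even
`ℂ_p`-valued character `χ` mod `p^{n+e₀}` of `p`-power order vanishes (evaluate at `χ(γ) − 1`).
[cite: Pollack2003, Prop. 6.9 (proof)] -/
theorem sumK_eq_zero_of_isCongrModOmegaO_zero {n : ℕ} {P : (PadicAlgCl p)[X]}
    (h : IsCongrModOmegaO (Set.range ι) n ((mazurTateElementK g Ω p n).map ι)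
      ((P : PowerSeries (PadicAlgCl p)) * iwasawaOToPowerSeries (Set.range ι) 0))
    (χ : DirichletCharacter ℂ_[p] (p ^ (n + cyclotomicExponent p))) (hev : χ.Even)
    (hord : ∃ j : ℕ, orderOf χ = p ^ j) :
    ∑ a : ZMod (p ^ (n + cyclotomicExponent p)),
        χ a * algebraMap (PadicAlgCl p) ℂ_[p]
          (ι (plusSymbolK g Ω ((a.val : ℚ) / (p : ℚ) ^ (n + cyclotomicExponent p)))) = 0 := by
  set ζ : ℂ_[p] := χ (cyclotomicGenerator p : ZMod (p ^ (n + cyclotomicExponent p))) with hζ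
  have hpow : ζ ^ p ^ n = 1 := by
    rw [hζ, ← map_pow, ← orderOf_cyclotomicGenerator p n, pow_orderOf_eq_one, map_one]
  have hz : ‖ζ - 1‖ < 1 := norm_sub_one_lt_one_of_pow_prime_pow_eq_one hpow
  have hzn : (1 + (ζ - 1)) ^ p ^ n = 1 := by rwa [add_sub_cancel]
  have h1 := IsCongrModOmegaO.eval₂_eq_mul h hz hzn
  rw [eval₂_map_mazurTateElementK_eq_sum g ι Ω χ hev hord] at h1
  rw [h1, map_zero]
  simp

set_option synthInstance.maxHeartbeats 200000 in
/-- **Rohrlich's theorem forbids the vanishing of all twisted sums of the partner along a parity class of levels**: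
if for some `a` every primitive even `p`-power-order `ℂ_p`-valued character `χ` of conductor `p^{2i+a+3}` (`i ≥ 0`) has
`Σ_b χ(b) ι[b/p^{2i+a+3}]⁺_{g,Ω} = 0`, we reach a contradiction (Birch's formula + Rohrlich 1984 for the newform `g`;
the two embeddings of an algebraic closure of `K_g`). [cite: RohrlichInventiones1984, Theorem (p. 409)] -/
theorem false_of_forall_sumK_eq_zero (hg : IsNewform0 g) (hΩ : IsPlusPeriod g Ω) (hpM : ¬ p ∣ M) (a : ℕ)
    (hvan : ∀ (i : ℕ) (χ : DirichletCharacter ℂ_[p] (p ^ (2 * i + a + 3))), χ.IsPrimitive → χ.Even →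
      (∃ j : ℕ, orderOf χ = p ^ j) →
      ∑ b : ZMod (p ^ (2 * i + a + 3)), χ b * algebraMap (PadicAlgCl p) ℂ_[p]
        (ι (plusSymbolK g Ω ((b.val : ℚ) / (p : ℚ) ^ (2 * i + a + 3)))) = 0) : False := by
  classical
  have hp : p.Prime := Fact.out
  have hR := Rohrlich1984_nonvanishing_twists_holds.primePow hg hpM
  -- an algebraic closure `F` of `K_g` with its two embeddings
  let F := AlgebraicClosure (coeffField g)
  let σ : F →ₐ[coeffField g] ℂ := IsAlgClosed.lift
  letI : Algebra (coeffField g) (PadicAlgCl p) := ι.toAlgebra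
  let τ : F →ₐ[coeffField g] PadicAlgCl p := IsAlgClosed.lift
  let φ : PadicAlgCl p →+* ℂ_[p] := algebraMap (PadicAlgCl p) ℂ_[p]
  have hσ : ∀ x : coeffField g, σ (algebraMap (coeffField g) F x) = (x : ℂ) := fun x ↦ σ.commutes x
  have hτ : ∀ x : coeffField g, τ (algebraMap (coeffField g) F x) = ι x := fun x ↦ τ.commutes x
  -- primitive even characters of `p`-power order with values in `F`
  have hψ : ∀ i : ℕ, ∃ ψ : DirichletCharacter F (p ^ (2 * i + a + 3)),
      ψ.IsPrimitive ∧ ψ.Even ∧ ∃ j : ℕ, orderOf ψ = p ^ j := fun i ↦ by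
    haveI : NeZero ((Nat.totient (p ^ (2 * i + a + 3)) : ℕ) : F) :=
      ⟨Nat.cast_ne_zero.mpr (Nat.totient_pos.mpr (pow_pos hp.pos _)).ne'⟩
    exact exists_isPrimitive_even_orderOf_eq_prime_pow F (2 * i + a)
  choose ψ hψprim hψeven hψord using hψ
  -- the twisted `K_g`-symbol sum in `F` vanishes (read in `ℂ_p` through `τ`)
  have hSF : ∀ i : ℕ, ∑ b : ZMod (p ^ (2 * i + a + 3)), ψ i b *
      algebraMap (coeffField g) F (plusSymbolK g Ω ((b.val : ℚ) / (p : ℚ) ^ (2 * i + a + 3))) = 0 := by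
    intro i
    haveI : NeZero (p ^ (2 * i + a + 3)) := ⟨pow_ne_zero _ hp.ne_zero⟩
    have hinj : Function.Injective (φ.comp τ.toRingHom) := (φ.comp τ.toRingHom).injective
    apply hinj
    rw [map_zero, map_sum]
    have hv := hvan i ((ψ i).ringHomComp (φ.comp τ.toRingHom))
      ((isPrimitive_ringHomComp_iff _ (ψ i)).mpr (hψprim i))
      ((even_ringHomComp_iff _ (ψ i)).mpr (hψeven i))
      (by rw [orderOf_ringHomComp]; exact hψord i)
    rw [← hv]
    refine Finset.sum_congr rfl fun b _ ↦ ?_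
    rw [map_mul, MulChar.ringHomComp_apply, RingHom.comp_apply, RingHom.comp_apply, AlgHom.toRingHom_eq_coe,
      AlgHom.coe_toRingHom, hτ]
  -- hence the complex twisted symbol sums vanish and `L(g, (σψ_i)⁻¹, 1) = 0` for every `i`
  have hbad : ∀ i : ℕ, (⟨p ^ (2 * i + a + 3), ((ψ i).ringHomComp (σ : F →+* ℂ))⁻¹⟩ :
      Σ m : ℕ, DirichletCharacter ℂ m) ∈
      {χ : Σ m : ℕ, DirichletCharacter ℂ m |
        χ.1 ≠ 0 ∧ χ.1.primeFactors ⊆ {p} ∧ χ.2.IsPrimitive ∧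
          ∃ L : ℂ → ℂ, Differentiable ℂ L ∧
            (∀ s : ℂ, 2 < s.re → L s = twistedLSeries g χ.2 s) ∧ L 1 = 0} := by
    intro i
    haveI : NeZero (p ^ (2 * i + a + 3)) := ⟨pow_ne_zero _ hp.ne_zero⟩
    have hprimC : DirichletCharacter.IsPrimitive ((ψ i).ringHomComp (σ : F →+* ℂ)) :=
      (isPrimitive_ringHomComp_iff _ (ψ i)).mpr (hψprim i)
    have hevenC : DirichletCharacter.Even ((ψ i).ringHomComp (σ : F →+* ℂ)) :=
      (even_ringHomComp_iff _ (ψ i)).mpr (hψeven i)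
    refine ⟨pow_ne_zero _ hp.ne_zero, (Nat.primeFactors_prime_pow (by omega) hp).le, ?_, ?_⟩
    · rw [DirichletCharacter.isPrimitive_def, DirichletCharacter.conductor_inv]
      exact hprimC
    obtain ⟨L, hLd, hL⟩ := exists_differentiable_eq_twistedLSeries_holds g ((ψ i).ringHomComp (σ : F →+* ℂ))⁻¹
    refine ⟨L, hLd, hL, ?_⟩
    have hBirch := twisted_LValue_eq_holds g (m := p ^ (2 * i + a + 3))
      (χ := ((ψ i).ringHomComp (σ : F →+* ℂ))⁻¹) (by
        rw [DirichletCharacter.isPrimitive_def, DirichletCharacter.conductor_inv]; exact hprimC) hLd hL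
    rw [inv_inv] at hBirch
    -- the twisted symbol sum of the even character `σψ_i` vanishes
    have hzero : twistedSymbolSum g ((ψ i).ringHomComp (σ : F →+* ℂ)) = 0 := by
      rw [twistedSymbolSum_eq_sum_plusSymbol (f := g) hevenC]
      have h0 := congrArg (σ : F →+* ℂ) (hSF i)
      rw [map_sum, map_zero] at h0
      have h1 : ∑ b : ZMod (p ^ (2 * i + a + 3)), ((ψ i).ringHomComp (σ : F →+* ℂ)) b *
          plusSymbol g ((b.val : ℚ) / (p ^ (2 * i + a + 3) : ℕ)) =
          Ω * ∑ b : ZMod (p ^ (2 * i + a + 3)), (σ : F →+* ℂ) (ψ i b *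
            algebraMap (coeffField g) F (plusSymbolK g Ω ((b.val : ℚ) / (p : ℚ) ^ (2 * i + a + 3)))) := by
        rw [Finset.mul_sum]
        refine Finset.sum_congr rfl fun b _ ↦ ?_
        rw [map_mul, MulChar.ringHomComp_apply]
        change _ = Ω * ((σ : F →+* ℂ) (ψ i b) * σ (algebraMap (coeffField g) F _))
        rw [hσ, IsPlusPeriod.coe_plusSymbolK g hΩ, Nat.cast_pow]
        field_simp [hΩ.ne_zero]
      rw [h1, h0, mul_zero]
    rw [hzero, mul_eq_zero] at hBirch
    exact hBirch.resolve_left (gaussSum_stdAddChar_ne_zero hprimC)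
  -- infinitely many distinct characters, contradicting Rohrlich
  let Fam : ℕ → Σ m : ℕ, DirichletCharacter ℂ m := fun i ↦
    ⟨p ^ (2 * i + a + 3), ((ψ i).ringHomComp (σ : F →+* ℂ))⁻¹⟩
  have hFinj : Function.Injective Fam := fun i l h ↦ by
    have h1 : p ^ (2 * i + a + 3) = p ^ (2 * l + a + 3) := congr_arg Sigma.fst h
    have := Nat.pow_right_injective hp.two_le h1
    omega
  have hfin : (Set.univ : Set ℕ).Finite := by
    refine (hR.preimage hFinj.injOn).subset fun i _ ↦ ?_
    exact hbad i
  exact Set.infinite_univ hfin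

end Bridge

/-! ## Stub (R1d) -/

/-- **Stub (R1d) `stub_pollackNonvanishingKAtTwo` of crux `ResidualThetaMainConjectureAtTwo` (line `birth` v7), VERBATIM**:
the partner's signed functions with the layer congruences are non-zero (see the module docstring).
[cite: Pollack2003, Cor. 5.11] [cite: RohrlichInventiones1984, Theorem (p. 409)] -/
theorem stub_pollackNonvanishingKAtTwo : ∀ (M : ℕ) [NeZero M] (g : CuspForm (CongruenceSubgroup.Gamma0 M) 2) (ι : Literature.NumberTheory.EllipticCurves.ModularForms.coeffField g →+* PadicAlgCl 2) (Ω : ℂ), Odd M → Literature.NumberTheory.EllipticCurves.ModularForms.IsNewform0 g → Literature.NumberTheory.Automorphic.IsCMForm (Literature.NumberTheory.EllipticCurves.ModularForms.liftToGamma1 M 2 g) → Literature.NumberTheory.EllipticCurves.ModularForms.cuspCoeff g 2 = 0 → Literature.NumberTheory.EllipticCurves.IsCohomologicalPlusPeriod g ι Ω → ∀ (Lp Lm : Literature.NumberTheory.EllipticCurves.IwasawaAlgebraO (Set.range ι)), (∀ n : ℕ, Odd n → Literature.NumberTheory.EllipticCurves.IsCongrModOmegaO (Set.range ι) n ((Literature.NumberTheory.EllipticCurves.mazurTateElementK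 g Ω 2 n).map ι) ((((((-1 : Polynomial ℤ)) ^ (n / 2 + 1) * Literature.NumberTheory.EllipticCurves.cyclotomicOmegaPlus 2 n).map (Int.castRingHom (PadicAlgCl 2)) : Polynomial (PadicAlgCl 2)) : PowerSeries (PadicAlgCl 2)) * Literature.NumberTheory.EllipticCurves.iwasawaOToPowerSeries (Set.range ι) Lp)) → (∀ n : ℕ, Even n → Literature.NumberTheory.EllipticCurves.IsCongrModOmegaO (Set.range ι) n ((Literature.NumberTheory.EllipticCurves.mazurTateElementK g Ω 2 n).map ι) ((((((-1 : Polynomial ℤ)) ^ (n / 2 + 1) * Literature.NumberTheory.EllipticCurves.cyclotomicOmegaMinus 2 n).map (Int.castRingHom (PadicAlgCl 2)) : Polynomial (PadicAlgCl 2)) : PowerSeries (PadicAlgCl 2)) * Literature.NumberTheory.EllipticCurves.iwasawaOToPowerSeries (Set.range ι) Lm)) → Lp ≠ 0 ∧ Lm ≠ 0 := by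
  intro M _ g ι Ω hodd hnew _hcm _ha2 hΩ Lp Lm hoddc hevenc
  have h2M : ¬ 2 ∣ M := hodd.not_two_dvd_nat
  have hIsP : IsPlusPeriod g Ω := hΩ.isPlusPeriod
  have he : cyclotomicExponent 2 = 2 := if_pos rfl
  refine ⟨fun hL0 ↦ ?_, fun hL0 ↦ ?_⟩
  · -- `L⁺ = 0`: odd levels `n = 2i + 1`, conductors `2^(2i+3) = 2^(n+2)`
    subst hL0
    refine false_of_forall_sumK_eq_zero (p := 2) (ι := ι) hnew hIsP h2M 0 fun i χ _ hev hord ↦ ?_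
    have hlev : ∀ (N' : ℕ) (hN' : N' = (2 * i + 1) + cyclotomicExponent 2)
        (χ : DirichletCharacter ℂ_[2] (2 ^ N')), χ.Even → (∃ j : ℕ, orderOf χ = 2 ^ j) →
        ∑ b : ZMod (2 ^ N'), χ b * algebraMap (PadicAlgCl 2) ℂ_[2]
          (ι (plusSymbolK g Ω ((b.val : ℚ) / (2 : ℚ) ^ N'))) = 0 := by
      intro N' hN' χ hev hord
      subst hN'
      exact sumK_eq_zero_of_isCongrModOmegaO_zero (hoddc (2 * i + 1) ⟨i, rfl⟩) χ hev hord
    have := hlev (2 * i + 0 + 3) (by rw [he]) χ hev hord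
    exact_mod_cast this
  · -- `L⁻ = 0`: even levels `n = 2i + 2`, conductors `2^(2i+4) = 2^(n+2)`
    subst hL0
    refine false_of_forall_sumK_eq_zero (p := 2) (ι := ι) hnew hIsP h2M 1 fun i χ _ hev hord ↦ ?_
    have hlev : ∀ (N' : ℕ) (hN' : N' = (2 * i + 2) + cyclotomicExponent 2)
        (χ : DirichletCharacter ℂ_[2] (2 ^ N')), χ.Even → (∃ j : ℕ, orderOf χ = 2 ^ j) →
        ∑ b : ZMod (2 ^ N'), χ b * algebraMap (PadicAlgCl 2) ℂ_[2]
          (ι (plusSymbolK g Ω ((b.val : ℚ) / (2 : ℚ) ^ N'))) = 0 := by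
      intro N' hN' χ hev hord
      subst hN'
      exact sumK_eq_zero_of_isCongrModOmegaO_zero (hevenc (2 * i + 2) ⟨i + 1, by ring⟩) χ hev hord
    have := hlev (2 * i + 1 + 3) (by rw [he]) χ hev hord
    exact_mod_cast this

end Summit.BirchSwinnertonDyer.BirchSwinnertonDyer.Theorems.ResidualThetaLayer

end
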